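import Summits.NavierStokesRegularity.NavierStokesRegularity.Theorems.EfficiencyFloorEnstrophyQuarterLawDssStratum
import Summits.NavierStokesRegularity.NavierStokesRegularity.Theorems.EfficiencyFloorProductionEfficiencyDecayReduction
import Summits.NavierStokesRegularity.NavierStokesRegularity.Theorems.EfficiencyFloorBlowupEnstrophyUnbounded
import HarnessLib

/-!
# Crux `EfficiencyFloor.ProductionEfficiencyDecay` (stmt-NavierStokesRegularity-22866): the FREQUENT form of the
# crux is free off the Leray-rate stratum — `PED ⟺ (no Leray-rate blow-up) ∧ (frequently ⇒ eventually)`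

`--supports stmt-NavierStokesRegularity-22866 --as helper` (line `efficiency_floor`; seat ns-ef-p4).

The crux-proper stub S2 asks that along every maximal smooth Leray–Hopf rapidly-decaying-datum solution, for every
`ε > 0`, EVENTUALLY (as `t ↑ T`) `0 < Z` and `Ż = 2S − 2ν·Pal ≤ ε Z³`. This file proves that the FREQUENT form of the
same conclusion is automatic for every solution that is not an enstrophy-Type-I (Leray-rate) blow-up:

* `two_mul_eps_le_inv_sq_sub` (real analysis, the reverse of the landed `stub_integrateEfficiency`): if `Ż ≥ ε Z³` on
  `[s,t]` then `Z(s)⁻² − Z(t)⁻² ≥ 2ε (t − s)`.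
* `frequently_depletion_or_quarterLaw` (THE DICHOTOMY): for every such solution, every real enstrophy function of the
  budget and every `ε > 0`, EITHER `0 < Z ∧ Ż ≤ ε Z³` holds FREQUENTLY as `t ↑ T`, OR the solution obeys the QUARTER LAW
  `∫⁻|curl u(t)|² ≤ ofReal (K/√(T−t))` on `[0,T)` for some `K` (sustained efficiency `Ż > εZ³` on a whole late window
  integrates to `Z(s) ≤ (2ε)^{−1/2}/√(T−s)`; the early part is bounded by the Tao-class sub-slab bound) — i.e. it is an
  inhabitant of the lead's `LerayRateBlowup` (the conclusion of the route's RESIDUAL stmt-1574 for this solution).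
* `frequently_depletion_of_not_lerayRateBlowup`: hence `¬ LerayRateBlowup` implies the frequent form of S2 for every
  solution and every `ε > 0`.
* `productionEfficiencyDecay_iff_not_lerayRate_and_upgrade` (FACTORISATION OF THE CRUX, by name):
  `ProductionEfficiencyDecay ↔ ¬ LerayRateBlowup ∧ U`, where `U` is the UPGRADE statement "for every solution and
  every ε, frequently (0 < Z ∧ Ż ≤ εZ³) ⇒ eventually (0 < Z ∧ Ż ≤ εZ³)" (no late oscillation of the Lu–Doering
  efficiency across any level ε). `→`: the lead's kill criterion (`ProductionEfficiencyDecay_false_of_LerayRateBlowup`)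
  and reduction (`depletion_of_productionEfficiencyDecay`); `←`: the dichotomy + the lead's
  `productionEfficiencyDecay_of_depletion`.

READ-OUT. The crux splits into exactly two named pieces: (i) NO LERAY-RATE BLOW-UP (the enemy the line already names:
on that stratum the residual jaw 1574 holds and the attacked jaw fails), and (ii) NO OSCILLATION of the efficiency at
blow-up for the remaining (limsup-enstrophy-Type-II) solutions — for those the efficiency DOES dip below every `ε`
arbitrarily close to `T` (proved here), and S2 asks that it stay there. Both pieces are open-problem grade; nothing here
proves either.

HONEST FRAMING: statements about HYPOTHETICAL blow-ups; the crux stmt-22866 and the residual stmt-1574 are NOT proved;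
NS regularity is NOT proved; no summit is proved. [folklore]
-/

-- the problem directory repeats the summit name (`NavierStokesRegularity/NavierStokesRegularity`)
set_option linter.dupNamespace false

noncomputable section

open Set Filter MeasureTheory Topology
open scoped InnerProductSpace ENNReal NNReal
open Literature.Analysis.FluidPDE

namespace Summit.NavierStokesRegularity.NavierStokesRegularity.Theorems

namespace ProductionEfficiencyDecay

namespace FrequentDepletion

open ProductionEfficiencyDecayNegative (LerayRateBlowup ProductionEfficiencyDecay_false_of_LerayRateBlowup)

/-! ### Real analysis: sustained efficiency integrates to the Leray rate -/

/-- **Reverse integration of the efficiency law**: if `Z > 0` on `[s,t]` and `Z` has at every point of `[s,t]` a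
derivative `D ≥ ε Z³`, then `2ε (t − s) ≤ Z(s)⁻² − Z(t)⁻²` (`τ ↦ Z(τ)⁻² + 2ετ` is antitone). [folklore] -/
theorem two_mul_eps_le_inv_sq_sub {Zr : ℝ → ℝ} {s t ε : ℝ} (hpos : ∀ τ ∈ Icc s t, 0 < Zr τ)
    (hder : ∀ τ ∈ Icc s t, ∃ D : ℝ, HasDerivAt Zr D τ ∧ ε * Zr τ ^ 3 ≤ D) (hst : s ≤ t) :
    2 * ε * (t - s) ≤ (Zr s)⁻¹ ^ 2 - (Zr t)⁻¹ ^ 2 := by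
  set f : ℝ → ℝ := fun τ => (Zr τ)⁻¹ ^ 2 + 2 * ε * τ with hf
  set f' : ℝ → ℝ := fun τ => -2 * deriv Zr τ / Zr τ ^ 3 + 2 * ε with hf'
  have hderf : ∀ τ ∈ Icc s t, HasDerivAt f (f' τ) τ := by
    intro τ hτ
    obtain ⟨D, hD, -⟩ := hder τ hτ
    have hne : Zr τ ≠ 0 := (hpos τ hτ).ne'
    have h1 : HasDerivAt f (-2 * D / Zr τ ^ 3 + 2 * ε * 1) τ :=
      (hasDerivAt_inv_sq hD hne).add ((hasDerivAt_id τ).const_mul (2 * ε))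
    show HasDerivAt f (-2 * deriv Zr τ / Zr τ ^ 3 + 2 * ε) τ
    rw [hD.deriv]
    exact h1.congr_deriv (by ring)
  have hnonpos : ∀ τ ∈ Icc s t, f' τ ≤ 0 := by
    intro τ hτ
    obtain ⟨D, hD, hDge⟩ := hder τ hτ
    have hZ3 : 0 < Zr τ ^ 3 := pow_pos (hpos τ hτ) 3
    show -2 * deriv Zr τ / Zr τ ^ 3 + 2 * ε ≤ 0
    rw [hD.deriv]
    have : ε ≤ D / Zr τ ^ 3 := (le_div_iff₀ hZ3).2 hDge
    have h2 : -2 * D / Zr τ ^ 3 = -2 * (D / Zr τ ^ 3) := by ring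
    rw [h2]
    linarith
  have hanti : AntitoneOn f (Icc s t) := by
    refine antitoneOn_of_hasDerivWithinAt_nonpos (f' := f') (convex_Icc s t)
      (fun τ hτ => (hderf τ hτ).continuousAt.continuousWithinAt) (fun τ hτ => ?_) fun τ hτ => ?_
    · exact (hderf τ (interior_subset hτ)).hasDerivWithinAt
    · exact hnonpos τ (interior_subset hτ)
  have h := hanti (left_mem_Icc.2 hst) (right_mem_Icc.2 hst) hst
  simp only [hf] at h
  linarith

/-! ### The dichotomy along a maximal solution -/

variable {ν T : ℝ} {u : ℝ → EuclideanSpace ℝ (Fin 3) → EuclideanSpace ℝ (Fin 3)}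
  {p : ℝ → EuclideanSpace ℝ (Fin 3) → ℝ}

/-- **FREQUENT DEPLETION OR QUARTER LAW.** Along a maximal smooth Leray–Hopf rapidly-decaying-datum solution on
`[0,T)` with a real enstrophy function `Zr` (`∫⁻‖curl u(t)‖ₑ² = ofReal (Zr t)`, `Zr ≥ 0` on `(0,T)`) differentiable with
derivative `2Sr − 2ν Pr` (the budget clauses), for every `ε > 0`: EITHER frequently as `t ↑ T` one has
`0 < Zr t ∧ 2Sr t − 2ν Pr t ≤ ε (Zr t)³` (the conclusion of the crux-proper stub S2, in FREQUENT form), OR the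
solution obeys the quarter law `∫⁻|curl u(t)|² ≤ ofReal (K/√(T−t))` on `[0,T)` for some `K`. [folklore] -/
theorem frequently_depletion_or_quarterLaw (hν : 0 < ν) (hT : 0 < T)
    (hmax : IsMaximalSmoothSolution ν 0 u p T) (hLH : IsLerayHopfOn T ν 0 (u 0) u)
    (hdec : HasRapidSpatialDecay (u 0)) {Zr Pr Sr : ℝ → ℝ}
    (hZeq : ∀ t ∈ Ioo 0 T, ∫⁻ x, ‖curl (u t) x‖ₑ ^ 2 = ENNReal.ofReal (Zr t))
    (hD : ∀ t ∈ Ioo 0 T, HasDerivAt Zr (2 * Sr t - 2 * ν * Pr t) t) {ε : ℝ} (hε : 0 < ε) :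
    (∃ᶠ t in 𝓝[<] T, 0 < Zr t ∧ 2 * Sr t - 2 * ν * Pr t ≤ ε * Zr t ^ 3) ∨
      ∃ K : ℝ, ∀ t ∈ Ico 0 T, ∫⁻ x, ‖curl (u t) x‖ₑ ^ 2 ≤ ENNReal.ofReal (K / Real.sqrt (T - t)) := by
  by_cases hfreq : ∃ᶠ t in 𝓝[<] T, 0 < Zr t ∧ 2 * Sr t - 2 * ν * Pr t ≤ ε * Zr t ^ 3
  · exact Or.inl hfreq
  right
  rw [Filter.not_frequently] at hfreq
  -- a late window `[t₁, T)`: `t ∈ (0,T)`, `Zr ≥ 1`, sustained efficiency `Ż > ε Z³`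
  have h2 := BlowupEnstrophyUnbounded.main hν hT hmax hLH hdec 1
  have h3 : ∀ᶠ t in 𝓝[<] T, t ∈ Ioo 0 T := Ioo_mem_nhdsLT hT
  obtain ⟨t₀, ht₀T, hsub⟩ := mem_nhdsLT_iff_exists_Ioo_subset.1 (hfreq.and (h2.and h3))
  set t₁ : ℝ := (max t₀ 0 + T) / 2 with ht₁
  have hm : max t₀ 0 < T := max_lt ht₀T hT
  have ht₁I : t₁ ∈ Ioo 0 T := ⟨by rw [ht₁]; linarith [le_max_right t₀ 0], by rw [ht₁]; linarith⟩
  have hwin : ∀ t ∈ Ico t₁ T, t ∈ Ioo 0 T ∧ 1 ≤ Zr t ∧ ε * Zr t ^ 3 < 2 * Sr t - 2 * ν * Pr t := by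
    intro t ht
    have ht₀t : t₀ < t := by
      have : max t₀ 0 < t₁ := by rw [ht₁]; linarith
      exact (le_max_left t₀ 0).trans_lt (this.trans_le ht.1)
    obtain ⟨hnv, hone, htI⟩ := hsub ⟨ht₀t, ht.2⟩
    have hZ1 : 1 ≤ Zr t := by
      rw [hZeq t htI, ENNReal.ofReal_le_ofReal_iff'] at hone
      rcases hone with h | h
      · exact h
      · exact absurd h (by norm_num)
    refine ⟨htI, hZ1, ?_⟩
    by_contra hle
    rw [not_lt] at hle
    exact hnv ⟨one_pos.trans_le hZ1, hle⟩
  -- late part: `Zr s ≤ (2ε)^{-1/2} / √(T−s)` on the window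
  have hlate : ∀ s ∈ Ico t₁ T, Zr s ≤ 1 / Real.sqrt (2 * ε) / Real.sqrt (T - s) := by
    intro s hs
    have hZs : 0 < Zr s := one_pos.trans_le (hwin s hs).2.1
    have hbound : ∀ t ∈ Ioo s T, 2 * ε * (t - s) ≤ (Zr s)⁻¹ ^ 2 := by
      intro t hst
      have hI : ∀ τ ∈ Icc s t, τ ∈ Ico t₁ T := fun τ hτ => ⟨hs.1.trans hτ.1, hτ.2.trans_lt hst.2⟩
      have hpos : ∀ τ ∈ Icc s t, 0 < Zr τ := fun τ hτ => one_pos.trans_le (hwin τ (hI τ hτ)).2.1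
      have hder : ∀ τ ∈ Icc s t, ∃ D : ℝ, HasDerivAt Zr D τ ∧ ε * Zr τ ^ 3 ≤ D := fun τ hτ =>
        ⟨_, hD τ (hwin τ (hI τ hτ)).1, (hwin τ (hI τ hτ)).2.2.le⟩
      have h := two_mul_eps_le_inv_sq_sub hpos hder hst.1.le
      have : 0 ≤ (Zr t)⁻¹ ^ 2 := by positivity
      linarith
    -- let `t ↑ T`
    have hlim : 2 * ε * (T - s) ≤ (Zr s)⁻¹ ^ 2 := by
      have htend : Tendsto (fun t : ℝ => 2 * ε * (t - s)) (𝓝[<] T) (𝓝 (2 * ε * (T - s))) :=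
        ((continuous_const.mul (continuous_id.sub continuous_const)).tendsto T).mono_left
          nhdsWithin_le_nhds
      exact le_of_tendsto htend (by filter_upwards [Ioo_mem_nhdsLT hs.2] with t ht using hbound t ht)
    have hTs : 0 < T - s := sub_pos.2 hs.2
    have h2ε : 0 < 2 * ε * (T - s) := by positivity
    have hsq : Zr s ^ 2 ≤ 1 / (2 * ε * (T - s)) := by
      rw [inv_pow] at hlim
      rw [le_one_div (pow_pos hZs 2) h2ε, one_div]
      exact hlim
    have h1 : Zr s ≤ Real.sqrt (1 / (2 * ε * (T - s))) := by
      rw [← Real.sqrt_sq hZs.le]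
      exact Real.sqrt_le_sqrt hsq
    have h2 : Real.sqrt (1 / (2 * ε * (T - s))) = 1 / Real.sqrt (2 * ε) / Real.sqrt (T - s) := by
      rw [Real.sqrt_div' _ h2ε.le, Real.sqrt_one, Real.sqrt_mul (by positivity), div_div]
    rwa [h2] at h1
  -- early part: the Tao-class sub-slab bound on `[0, t₁]`
  obtain ⟨M, hM⟩ :=
    EnstrophyQuarterLawDssStratum.exists_lintegral_curl_sq_le_on_Icc hν hT hmax hLH hdec ht₁I.2
  refine ⟨max ((M : ℝ) * Real.sqrt T) (1 / Real.sqrt (2 * ε)), fun t ht => ?_⟩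
  have hTt : 0 < T - t := sub_pos.2 ht.2
  have hsT : 0 < Real.sqrt (T - t) := Real.sqrt_pos.2 hTt
  by_cases hle : t ≤ t₁
  · -- `Z(t) ≤ M ≤ M√T/√(T−t) ≤ K/√(T−t)`
    have h1 : ∫⁻ x, ‖curl (u t) x‖ₑ ^ 2 ≤ ENNReal.ofReal (M : ℝ) := by
      rw [ENNReal.ofReal_coe_nnreal]; exact hM t ⟨ht.1, hle⟩
    refine h1.trans (ENNReal.ofReal_le_ofReal ?_)
    rw [le_div_iff₀ hsT]
    have hsq : Real.sqrt (T - t) ≤ Real.sqrt T := Real.sqrt_le_sqrt (by linarith [ht.1])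
    calc (M : ℝ) * Real.sqrt (T - t) ≤ (M : ℝ) * Real.sqrt T :=
          mul_le_mul_of_nonneg_left hsq M.coe_nonneg
      _ ≤ max ((M : ℝ) * Real.sqrt T) (1 / Real.sqrt (2 * ε)) := le_max_left _ _
  · rw [not_le] at hle
    have htI : t ∈ Ico t₁ T := ⟨hle.le, ht.2⟩
    rw [hZeq t (hwin t htI).1]
    refine ENNReal.ofReal_le_ofReal ((hlate t htI).trans ?_)
    exact div_le_div_of_nonneg_right (le_max_right _ _) hsT.le

/-- **Absent Leray-rate blow-ups, the crux holds in FREQUENT form**: if no maximal smooth Leray–Hopf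
rapidly-decaying-datum solution obeys the quarter law (`¬ LerayRateBlowup`, the lead's negative-modulo hypothesis
negated), then along every such solution with budget triple `(Zr, Pr, Sr)` and for every `ε > 0`, frequently as
`t ↑ T`: `0 < Zr t ∧ 2Sr t − 2ν Pr t ≤ ε (Zr t)³`. [folklore] -/
theorem frequently_depletion_of_not_lerayRateBlowup (hno : ¬ LerayRateBlowup) (hν : 0 < ν) (hT : 0 < T)
    (hmax : IsMaximalSmoothSolution ν 0 u p T) (hLH : IsLerayHopfOn T ν 0 (u 0) u)
    (hdec : HasRapidSpatialDecay (u 0)) {Zr Pr Sr : ℝ → ℝ}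
    (hZeq : ∀ t ∈ Ioo 0 T, ∫⁻ x, ‖curl (u t) x‖ₑ ^ 2 = ENNReal.ofReal (Zr t))
    (hD : ∀ t ∈ Ioo 0 T, HasDerivAt Zr (2 * Sr t - 2 * ν * Pr t) t) {ε : ℝ} (hε : 0 < ε) :
    ∃ᶠ t in 𝓝[<] T, 0 < Zr t ∧ 2 * Sr t - 2 * ν * Pr t ≤ ε * Zr t ^ 3 := by
  rcases frequently_depletion_or_quarterLaw hν hT hmax hLH hdec hZeq hD hε with h | ⟨K, hK⟩
  · exact h
  · exact absurd ⟨ν, T, u, p, hν, hT, hmax, hLH, hdec, K, hK⟩ hno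

/-- **FACTORISATION OF THE CRUX.** `EfficiencyFloor.ProductionEfficiencyDecay` holds if and only if (i) there is no
Leray-rate blow-up (`¬ LerayRateBlowup`) AND (ii) the UPGRADE statement holds: along every maximal smooth
Leray–Hopf rapidly-decaying-datum solution with budget triple `(Zr, Pr, Sr)` (clauses of the registered stub S2,
verbatim) and for every `ε > 0`, if `0 < Zr ∧ Ż ≤ ε Zr³` holds frequently as `t ↑ T` then it holds on a whole late
window. Both (i) and (ii) are open-problem grade; this is bookkeeping by name, not progress on either. [folklore] -/
theorem productionEfficiencyDecay_iff_not_lerayRate_and_upgrade :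
    Summit.NavierStokesRegularity.NavierStokesRegularity.Theses.EfficiencyFloor.ProductionEfficiencyDecay ↔
      (¬ LerayRateBlowup ∧
        ∀ (c ν T : ℝ), 0 < c → 0 < ν → 0 < T →
          ∀ (u : ℝ → EuclideanSpace ℝ (Fin 3) → EuclideanSpace ℝ (Fin 3))
            (p : ℝ → EuclideanSpace ℝ (Fin 3) → ℝ),
            Literature.Analysis.FluidPDE.IsMaximalSmoothSolution ν 0 u p T →
            Literature.Analysis.FluidPDE.IsLerayHopfOn T ν 0 (u 0) u →
            Literature.Analysis.FluidPDE.HasRapidSpatialDecay (u 0) →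
            ∀ (Zr Pr Sr : ℝ → ℝ), (∀ t ∈ Set.Ioo 0 T,
              ∫⁻ x, ‖Literature.Analysis.FluidPDE.curl (u t) x‖ₑ ^ 2 = ENNReal.ofReal (Zr t) ∧ 0 ≤ Zr t ∧
              0 ≤ Pr t ∧
              Pr t = ∫ x, Literature.Analysis.FluidPDE.frobeniusNormSq
                (fderiv ℝ (Literature.Analysis.FluidPDE.curl (u t)) x) ∧
              Sr t = ∫ x, ⟪Literature.Analysis.FluidPDE.curl (u t) x,
                fderiv ℝ (u t) x (Literature.Analysis.FluidPDE.curl (u t) x)⟫_ℝ ∧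
              HasDerivAt Zr (2 * Sr t - 2 * ν * Pr t) t ∧
              |Sr t| ≤ c * Zr t ^ (3 / 4 : ℝ) * Pr t ^ (3 / 4 : ℝ)) →
            ∀ ε : ℝ, 0 < ε →
              (∃ᶠ t in 𝓝[<] T, 0 < Zr t ∧ 2 * Sr t - 2 * ν * Pr t ≤ ε * Zr t ^ 3) →
              ∃ t₁ ∈ Set.Ioo 0 T, ∀ t ∈ Set.Ico t₁ T, 0 < Zr t ∧ 2 * Sr t - 2 * ν * Pr t ≤ ε * Zr t ^ 3) := by
  constructor
  · intro hE
    refine ⟨fun hH => ProductionEfficiencyDecay_false_of_LerayRateBlowup hH hE, ?_⟩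
    intro c ν T hc hν hT u p hmax hLH hdec Zr Pr Sr hB ε hε _
    exact depletion_of_productionEfficiencyDecay hE c ν T hc hν hT u p hmax hLH hdec Zr Pr Sr hB ε hε
  · rintro ⟨hno, hU⟩
    refine productionEfficiencyDecay_of_depletion ?_
    intro c ν T hc hν hT u p hmax hLH hdec Zr Pr Sr hB ε hε
    exact hU c ν T hc hν hT u p hmax hLH hdec Zr Pr Sr hB ε hε
      (frequently_depletion_of_not_lerayRateBlowup hno hν hT hmax hLH hdec (fun t ht => (hB t ht).1)
        (fun t ht => (hB t ht).2.2.2.2.2.1) hε)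

end FrequentDepletion

end ProductionEfficiencyDecay

end Summit.NavierStokesRegularity.NavierStokesRegularity.Theorems

end
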